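import Summits.QuantumFields.YangMills.Theorems.UnitScaleTiltProp8HalvingSliceDictionary
import Summits.QuantumFields.YangMills.Theorems.UnitScaleTiltProp8FlatCubeLevels
import HarnessLib

/-!
# Route `UnitScaleTilt`, crux K1 child «MinimiserStabilityRegPr» (stmt-QuantumFields-19200), registered stub V2′ `stub_halvingStep` (v10 `BirthV10`) —
# **J5b TRANSPORT, PART 1 (carrier-free): THE LANDAU MULTIPLIER FORM (iv) IS CELL-CONSTANCY OF `Δ∂*A` ON THE INDEX CELLS** — for a nested family
# `D` of the torus, a field `f` (read: `f = Δ_{L^{K−n}}∂*_{L^{K−n}}A`) has the matrix-multiplier form `f(s) = Σ_{i∈𝔅}(Q′_{j(i)}e_s)(i)•μ(i)` as soon as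
# it is CONSTANT ON EVERY INDEX CELL `{s ∕∕ Bʲs = y}`, `y ∈ Λ_j` — the currency in which (iv) transports along an inclusion of cube towers (LEAD-H
# RULING L-5 (D1): each route cell lies in ONE cell of N05's tower)

Cell `ym3-torus` (HUMAN RULING D-0037, YM ladder rung R3 — continuum SU(2) YM₃ on the three-torus is a RUNG, NOT the Clay problem), width seat `ym-ust-19936-w7`
gen 4, cross-item hand on line H (★★OWNER ACK 45 (a) J5; LEAD-H L-5 «J5b := transport of (iii)∕(iv)∕(vi)∕(vii) along J1b»; tag worded by the OWNER:
`--supports stmt-QuantumFields-19200 --as helper`).  Definition-free, 0 sorry, standard axioms.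

WHY.  Conjunct (iv) of ✓`HalvingP1FlatPillarPrime.P1FlatPillarAt'` reads `∃ μ : 𝔅 → M₂(ℂ), ∀ s, Δ∂*A(s) = Σ_{i∈𝔅}(Q′_{j(i)}e_s)(i)•μ(i)` on the route's tower
`cubeSeqMT3`.  By ✓`HalvingSliceDictionary.sum_siteIdx_single_smul` the sum collapses to the block ancestors of `s`, and by ✓`FlatCubeLevels.levOf_inOm_eq_iff`
exactly ONE ancestor `(j(s), B^{j(s)}s)` is an index cell; so (iv) says precisely: `Δ∂*A` takes one value on each index cell (times `L^{−3j}`).  N05's Landau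
condition at its own member says the same on N05's cells (✓`IsLandau138` ∕ `QT_flat_apply`), and J1b's levelwise inclusion puts every route cell of positive
level inside one N05 cell — so (iv) transports by restriction.  THIS FILE is the route-side half, free of N05 letters and of J1b:
* §1 ★ `sum_siteIdx_single_smul_eq_level` — the collapsed sum is the single term at the level `j(s)` of `s`.
* §2 ★★ `multiplierForm_of_cellConst` — cell-constancy `(∀ j y, Λ_j ∋ y → ∀ s, Bʲs = y → f s = ν j y) ⟹ ∃ μ, ∀ s, f s = Σ_i (Q′e_s)(i)•μ(i)`
  (`μ (j,y) := L^{3j}•ν j y`); ★ `cellConst_of_multiplierForm` — the converse (so the currency is exact).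
HONEST SCOPE.  Finite bookkeeping over landed identities; NOTHING of J4 (the contraction) or of J1b (the geometry) is proved here.  NOT a claim about
[Balaban1985RegularSpaces] Thm 2, the stub, the crux, the rung or the mass gap; no summit statement is proved by this seat.

References: T. Bałaban, CMP **96** (1984) 223–250 [Balaban1984PropagatorsII] (2.3)–(2.4) p.224, (2.14)–(2.15) p.225; CMP **99** (1985) 75–102 [Balaban1985RegularSpaces]
(1.38) p.82; CMP **102** (1985) 277–309 [Balaban1985Variational] (153) p.301.
-/

set_option autoImplicit false

noncomputable section

open scoped BigOperators

namespace Summit.QuantumFields.YangMills.Theorems.HalvingP1FlatCoreTransport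

open Literature.MathematicalPhysics.QuantumFieldTheory.Balaban1983to89
open B5Eq118OneStroke (iterBlockOf)
open B6SectADomainsV1 (Domains)
open B6SectAOperatorsV1 (SiteIdx)
open B11Eq115Space (levOf)
open LatticeFieldCalculus (siteAvgIter)
open HalvingSliceDictionary (sum_siteIdx_single_smul)
open FlatCubeLevels (levOf_inOm_eq_iff lamSite_levOf_inOm levOf_inOm_le levOf_inOm_unique)

variable {P : Params} (D : Domains P) {V : Type*} [AddCommGroup V] [Module ℝ V]

/-! ## §1 The collapsed sum is the term at the level of `s` -/

/-- ★ **`Σ_{i∈𝔅}(Q′_{j(i)}e_s)(i)•ν(i) = L^{−d·j(s)}•ν(j(s), B^{j(s)}s)`** with `j(s) = levOf Ω_D k s` the level of the fine site `s` — the ONE block ancestor of `s` that is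
an index cell. [cite: Balaban1984PropagatorsII, (2.3)-(2.4) p.224, (2.14)-(2.15) p.225] -/
theorem sum_siteIdx_single_smul_eq_level (ν : (j : ℕ) → Site P j → V) (s : Site P 0) :
    ∑ i : SiteIdx D, siteAvgIter (i.1.1 : ℕ) (Pi.single s (1 : ℝ)) i.1.2 • ν i.1.1 i.1.2 =
      (((P.L : ℝ) ^ P.d) ^ (levOf (fun i => {y : Site P 0 | D.InOm i y}) D.k s))⁻¹ •
        ν (levOf (fun i => {y : Site P 0 | D.InOm i y}) D.k s) (iterBlockOf (levOf (fun i => {y : Site P 0 | D.InOm i y}) D.k s) s) := by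
  classical
  set j₀ : ℕ := levOf (fun i => {y : Site P 0 | D.InOm i y}) D.k s with hj₀
  rw [sum_siteIdx_single_smul D ν s]
  have hmem : j₀ ∈ Finset.range (D.k + 1) := Finset.mem_range.2 (Nat.lt_succ_of_le (levOf_inOm_le D s))
  rw [Finset.sum_eq_single_of_mem j₀ hmem]
  · rw [if_pos (lamSite_levOf_inOm D s)]
  · intro j _ hj
    rw [if_neg]
    intro h
    exact hj ((levOf_inOm_unique D h).symm ▸ rfl)

/-! ## §2 Multiplier form ⟺ cell-constancy -/

/-- ★★ **CELL-CONSTANCY ⟹ THE MULTIPLIER FORM**: if `f` takes the value `ν j y` on every fine site of the index cell `{s ∕∕ Bʲs = y}`, `y ∈ Λ_j`, then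
`f(s) = Σ_{i∈𝔅}(Q′_{j(i)}e_s)(i)•μ(i)` with `μ(j,y) := L^{d·j}•ν j y` — conjunct (iv) of ✓`P1FlatPillarAt'` in the cell currency (`f := Δ∂*A`).
[cite: Balaban1984PropagatorsII, (2.14)-(2.15) p.225; Balaban1985RegularSpaces, (1.38) p.82; Balaban1985Variational, (153) p.301] -/
theorem multiplierForm_of_cellConst {f : Site P 0 → V} (ν : (j : ℕ) → Site P j → V)
    (hcell : ∀ (j : ℕ) (y : Site P j), D.LamSite j y → ∀ s : Site P 0, iterBlockOf j s = y → f s = ν j y) :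
    ∃ μ : SiteIdx D → V, ∀ s : Site P 0, f s = ∑ i : SiteIdx D, siteAvgIter (i.1.1 : ℕ) (Pi.single s (1 : ℝ)) i.1.2 • μ i := by
  refine ⟨fun i => (((P.L : ℝ) ^ P.d) ^ (i.1.1 : ℕ)) • ν i.1.1 i.1.2, fun s => ?_⟩
  have h := sum_siteIdx_single_smul_eq_level D (fun j y => (((P.L : ℝ) ^ P.d) ^ j) • ν j y) s
  rw [h, smul_smul, inv_mul_cancel₀ (pow_ne_zero _ (pow_ne_zero _ (Nat.cast_ne_zero.2 P.L_pos.ne'))), one_smul]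
  exact hcell _ _ (lamSite_levOf_inOm D s) s rfl

/-- ★ **THE MULTIPLIER FORM ⟹ CELL-CONSTANCY**: conversely `f(s) = Σ_i (Q′e_s)(i)•μ(i)` forces `f` to take the value `L^{−d·j}•μ(j,y)` on the whole cell of
`(j, y) ∈ 𝔅`. [cite: Balaban1984PropagatorsII, (2.14)-(2.15) p.225; Balaban1985RegularSpaces, (1.38) p.82] -/
theorem cellConst_of_multiplierForm {f : Site P 0 → V} (μ : SiteIdx D → V)
    (hμ : ∀ s : Site P 0, f s = ∑ i : SiteIdx D, siteAvgIter (i.1.1 : ℕ) (Pi.single s (1 : ℝ)) i.1.2 • μ i)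
    (i : SiteIdx D) (s : Site P 0) (hs : iterBlockOf (i.1.1 : ℕ) s = i.1.2) :
    f s = (((P.L : ℝ) ^ P.d) ^ (i.1.1 : ℕ))⁻¹ • μ i := by
  classical
  -- extend `μ` to all pairs `(j, y)` (value irrelevant off `𝔅`)
  let ν : (j : ℕ) → Site P j → V := fun j y =>
    if h : ∃ hj : j < D.k + 1, D.LamSite j y then μ ⟨⟨⟨j, h.1⟩, y⟩, h.2⟩ else 0
  have hν : ∀ i' : SiteIdx D, ν i'.1.1 i'.1.2 = μ i' := by
    intro i'
    have hex : ∃ hj : (i'.1.1 : ℕ) < D.k + 1, D.LamSite (i'.1.1 : ℕ) i'.1.2 := ⟨i'.1.1.isLt, i'.2⟩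
    show (if h : ∃ hj : (i'.1.1 : ℕ) < D.k + 1, D.LamSite (i'.1.1 : ℕ) i'.1.2 then μ ⟨⟨⟨i'.1.1, h.1⟩, i'.1.2⟩, h.2⟩ else 0) = μ i'
    rw [dif_pos hex]
  have hsum : ∑ i' : SiteIdx D, siteAvgIter (i'.1.1 : ℕ) (Pi.single s (1 : ℝ)) i'.1.2 • μ i' =
      ∑ i' : SiteIdx D, siteAvgIter (i'.1.1 : ℕ) (Pi.single s (1 : ℝ)) i'.1.2 • ν i'.1.1 i'.1.2 :=
    Finset.sum_congr rfl fun i' _ => by rw [hν]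
  have hlev : levOf (fun l => {y : Site P 0 | D.InOm l y}) D.k s = (i.1.1 : ℕ) :=
    levOf_inOm_unique D (hs ▸ i.2 : D.LamSite (i.1.1 : ℕ) (iterBlockOf (i.1.1 : ℕ) s))
  rw [hμ s, hsum, sum_siteIdx_single_smul_eq_level D ν s, hlev, hs, hν]

end Summit.QuantumFields.YangMills.Theorems.HalvingP1FlatCoreTransport

end
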